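import Summits.QuantumAdvantage.QuantumAdvantage.Theorems.SparsityDialMP13

/-!
# SparsityDial — part MP14 of 14 of the «MovingPointers» package (decomp-qadv lens 2, g18): §J LOCAL (bounded-range) HASHES — `IsLocalHash`, `LocalHashTableLossG3 w` (`w = 0` PROVED)

Imports its predecessor `SparsityDialMP13` (linear chain MP1 → … → MP14); the package overview is the module docstring of `SparsityDialMP1`.
This part: the residual of piece S cut by RANGE — a hash trit is `w`-local if it is a sum of terms each reading the cyclic window
`[i, i+w]` (`w = 0` ⊇ affine hashes `isLocalHash_linPoly`; `w = 1` ∋ the banded quadratic form `isLocalHash_quadBand`); tables indexed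
by polylog many `w`-local trits: `LocalHashTableLossG3 w`, monotone in `w` (`localHashTableLossG3_anti`), `w = 0` PROVED
(`localHashTableLossG3_zero`: a `0`-local hash is affine, `local0_affine`); `w ≥ 1` open (the instrumentable half of the residual).
No `sorry`; standard axioms; no instances / notation.
-/

set_option linter.unusedVariables false
set_option linter.dupNamespace false

noncomputable section
open scoped Classical

namespace Summit.QuantumAdvantage.QuantumAdvantage.Theorems.SparsityDial

open Finset
open Literature.Computability.QuantumComplexity Literature.Computability.QuantumComplexity.RingHLF
open Literature.Computability.MetaComplexity Literature.Computability.MetaComplexity.Smolensky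
open Summit.QuantumAdvantage.AdviceFreeQNC0
open Summit.QuantumAdvantage.QuantumAdvantage.Theorems.HolonomyDial (gCond)
open Summit.QuantumAdvantage.QuantumAdvantage.Theorems.LocusDial
open Summit.QuantumAdvantage.QuantumAdvantage.Theorems.AnchorDial (dev outB win_iff card_odd_ge)
open Summit.QuantumAdvantage.QuantumAdvantage.Theorems.HolonomyDial (card_odd_le)
open Summit.QuantumAdvantage.QuantumAdvantage.Theorems.StabilizerDial (eventually_polylog StabFew stabFew_of_fewLocus)

/-! ## §J  THE RESIDUAL OF S, CUT ONCE MORE: LOCAL (bounded-bandwidth) hashes vs NON-LOCAL high-arity hashes — `LocalHashTableLossG3 w` -/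

section Local
variable {N : ℕ}

open Summit.QuantumAdvantage.QuantumAdvantage.Theorems.StabilizerDial (pad winset_pad)

/-- **`w`-local hash trit**: `h = Σ_i f_i` where the `i`-th summand depends only on the bits in the CYCLIC window `[i, i+w]`
(nearest-neighbour interactions of range `w` along the ring: `w = 0` ⊇ the affine hashes, `w = 1` ∋ the banded quadratic form
`Σ_i [x_i][x_{i+1}]`, …).  The class is incomparable with low degree: degree is not bounded, arity is not bounded, RANGE is. -/
def IsLocalHash (w : ℕ) (h : CubeFn (ZMod 3) N) : Prop := ∃ f : Fin N → CubeFn (ZMod 3) N,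
  (∀ i, ∀ x y : Fin N → Bool, (∀ j : Fin N, (i.val ≤ j.val ∧ j.val ≤ i.val + w) ∨ j.val + N ≤ i.val + w → x j = y j) →
    f i x = f i y) ∧ ∀ x, h x = ∑ i, f i x

/-- locality is monotone in the range. -/
theorem IsLocalHash.mono {w w' : ℕ} (hw : w ≤ w') {h : CubeFn (ZMod 3) N} (hl : IsLocalHash w h) : IsLocalHash w' h := by
  obtain ⟨f, hf, hh⟩ := hl
  refine ⟨f, fun i x y hxy => hf i x y fun j hj => hxy j ?_, hh⟩
  rcases hj with hj | hj
  · exact Or.inl ⟨hj.1, by omega⟩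
  · exact Or.inr (by omega)

/-- the affine hashes are `0`-local. -/
theorem isLocalHash_linPoly {t : ℕ} (M : Fin t → Fin N → ZMod 3) (s : Fin t) : IsLocalHash 0 (linPoly M s) := by
  refine ⟨fun i x => M s i * (if x i then 1 else 0), fun i x y hxy => ?_, fun x => ?_⟩
  · have : x i = y i := hxy i (Or.inl ⟨le_rfl, by omega⟩)
    simp [this]
  · rw [linPoly_apply]; rfl

/-- the cyclic successor index. -/
def nxtIdx (i : Fin N) : Fin N := ⟨(i.val + 1) % N, Nat.mod_lt _ i.pos⟩

/-- SparsityDial «MovingPointers» helper `nxtIdx_val` (decomp-qadv lens-2 g18 land package; see the module docstring). -/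
theorem nxtIdx_val (i : Fin N) : (nxtIdx i).val = if i.val + 1 < N then i.val + 1 else 0 := by
  unfold nxtIdx
  split_ifs with h
  · exact Nat.mod_eq_of_lt h
  · have : i.val + 1 = N := by omega
    simp [this]

/-- **non-vacuity of range `1`**: the banded quadratic form `Σ_i [x_i][x_{i+1}]` (cyclic) is a `1`-local hash — and it is not a
function of polylog many linear forms, so it lies outside the decided affine / junta classes. -/
theorem isLocalHash_quadBand :
    IsLocalHash 1 (fun x : Fin N → Bool => ∑ i : Fin N, (if x i then (1 : ZMod 3) else 0) * (if x (nxtIdx i) then 1 else 0)) := by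
  refine ⟨fun i x => (if x i then (1 : ZMod 3) else 0) * (if x (nxtIdx i) then 1 else 0), fun i x y hxy => ?_, fun x => rfl⟩
  have h1 : x i = y i := hxy i (Or.inl ⟨le_rfl, by omega⟩)
  have h2 : x (nxtIdx i) = y (nxtIdx i) := by
    apply hxy
    have hv := nxtIdx_val i
    split_ifs at hv with h
    · exact Or.inl ⟨by omega, by omega⟩
    · exact Or.inr (by omega)
  show (if x i then (1 : ZMod 3) else 0) * (if x (nxtIdx i) then 1 else 0) =
    (if y i then (1 : ZMod 3) else 0) * (if y (nxtIdx i) then 1 else 0)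
  rw [h1, h2]

/-- **a `0`-local hash is affine**: `h x = linHash M x + β` for the row `M i = f_i(1) − f_i(0)` and the constant `β = Σ_i f_i(0)`. -/
theorem local0_affine {h : CubeFn (ZMod 3) N} (hl : IsLocalHash 0 h) :
    ∃ (m : Fin N → ZMod 3) (β : ZMod 3), ∀ x, h x = (∑ i, m i * (if x i then 1 else 0)) + β := by
  obtain ⟨f, hf, hh⟩ := hl
  let g : Fin N → Bool → ZMod 3 := fun i b => f i (fun j => if j = i then b else false)
  have hg : ∀ i x, f i x = g i (x i) := by
    intro i x
    apply hf
    intro j hj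
    have hji : j = i := by
      rcases hj with hj | hj
      · exact Fin.ext (by omega)
      · exact absurd hj (by omega)
    subst hji; simp
  refine ⟨fun i => g i true - g i false, ∑ i, g i false, fun x => ?_⟩
  rw [hh x, ← Finset.sum_add_distrib]
  refine Finset.sum_congr rfl fun i _ => ?_
  rw [hg i x]
  cases x i <;> simp

/-- **`LocalHashTableLossG3 w`** — tables indexed by `t ≤ (log₂ n)^c` hash trits that are `w`-LOCAL (range-`w` interactions along the
ring), values of size `≤ (log₂ n)^c`, after an arbitrary gauge, lose.  `w = 0` is PROVED below (it is the affine-table rung); every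
fixed `w ≥ 1` is OPEN and is the INSTRUMENTABLE half of the residual of S: the fibre method extends to it by a twisted transfer operator
with a `2^w`-state memory (the engine shape of the sibling node «DigitDial» §11 for its walk problem), no correlation bound against
non-local low-degree phases being needed — it sits OUTSIDE `NonclassicalDegreeLogBarrier`'s regime.  The complementary half — hashes of
low degree but UNBOUNDED RANGE and high arity — is where that barrier bites. -/
def LocalHashTableLossG3 (w : ℕ) : Prop := ∃ C : ℕ, ∀ c : ℕ, ∃ n₀ : ℕ, ∀ n ≥ n₀, ∀ t ≤ (Nat.log 2 n) ^ c,
  ∀ (h : Fin t → CubeFn (ZMod 3) n) (S : (Fin t → ZMod 3) → Finset (Fin n)),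
    (∀ r, IsLocalHash w (h r)) → (∀ v, (S v).card ≤ (Nat.log 2 n) ^ c) →
    ∀ P : Fin n → CubeFn (ZMod 3) n,
      (∃ s : Fin n → CubeFn (ZMod 3) n, ∀ x, OddZeros x → dev (pad P s) x = S (fun r => h r x)) →
      ((univ.filter fun x : Fin n → Bool => OddZeros x ∧ Rel x (fun i => decide (P i x = 1))).card : ℝ) ≤
        (1 - 1 / (n : ℝ) ^ C) * (2 : ℝ) ^ (n - 1)

/-- the ladder is monotone: range `w'` contains range `w ≤ w'`. -/
theorem localHashTableLossG3_anti {w w' : ℕ} (hw : w ≤ w') (h : LocalHashTableLossG3 w') : LocalHashTableLossG3 w := by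
  obtain ⟨C, hC⟩ := h
  refine ⟨C, fun c => ?_⟩
  obtain ⟨n₀, hn₀⟩ := hC c
  exact ⟨n₀, fun n hn t ht hh S hl hcard P hs => hn₀ n hn t ht hh S (fun r => (hl r).mono hw) hcard P hs⟩

/-- **rung `w = 0` PROVED**: `0`-local hashes are affine (`local0_affine`), the constant shift is absorbed into the table, and the
gauged affine-table rung applies. -/
theorem local0_of_tableG (hT : AffineTableLossG3) : LocalHashTableLossG3 0 := by
  obtain ⟨C, hC⟩ := hT
  refine ⟨C, fun c => ?_⟩
  obtain ⟨n₀, hn₀⟩ := hC c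
  refine ⟨n₀, fun n hn t ht h S hl hcard P hs => ?_⟩
  choose m β hmβ using fun r => local0_affine (hl r)
  obtain ⟨s, hdev⟩ := hs
  refine hn₀ n hn t ht (fun r i => m r i) (fun v => S (fun r => v r + β r)) (fun v => hcard _) P ⟨s, fun x hx => ?_⟩
  rw [hdev x hx]
  congr 1
  funext r
  rw [hmβ r x]
  rfl

/-- **PROVED.** -/
theorem localHashTableLossG3_zero : LocalHashTableLossG3 0 := local0_of_tableG affineTableLossG3

end Local

/-- info: 'Summit.QuantumAdvantage.QuantumAdvantage.Theorems.SparsityDial.localHashTableLossG3_zero' depends on axioms: [propext,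
 Classical.choice,
 Quot.sound] -/
#guard_msgs in #print axioms localHashTableLossG3_zero

/-- info: 'Summit.QuantumAdvantage.QuantumAdvantage.Theorems.SparsityDial.local0_affine' depends on axioms: [propext,
 Classical.choice,
 Quot.sound] -/
#guard_msgs in #print axioms local0_affine



end Summit.QuantumAdvantage.QuantumAdvantage.Theorems.SparsityDial
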